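import Summits.HubbardSuperconductivity.HubbardSuperconductivity.Theorems.BirComplexStableXY.Negative.BirComplexStableXYFalseOfWitnessZeroExists

/-!
# Continuity of the witness partition function in the table parameters
(`BalabanIR.BirComplexStableXY`, stmt-HubbardSuperconductivity-2080, line `theta-rotor-equimodular-zeros`, S0)

For the witness table `witness ε₁ ε₂` of the negative lane
(`Theorems/BirComplexStableXY/Negative/WitnessTable.lean`) the crux's partition function
`Z = partZ K (witness ε₁ ε₂) L M = ∫_cube e^{-A}` is jointly continuous in `(ε₁, ε₂) ∈ ℝ × ℝ`.
Proof: dominated convergence on the cube `[0,2π]^Λ` (`MeasureTheory.continuous_of_dominated`).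
The integrand `e^{-A}` is jointly continuous in `((ε₁, ε₂), θ)` because the generating function of the
witness is affine in `(ε₁, ε₂)` (`genF_add`, `genF_smul`) with coefficients that are finite sums of
exponentials of real linear forms in `θ`; and its modulus `e^{-Re A} = e^{-K Σ_s S12}` does not depend on
`(ε₁, ε₂)` at all (`genF_witness_re`), so the integrand at `(0,0)` is an exact, continuous, hence
integrable (compact cube) dominating function.  No definitions, no hypotheses.
-/

namespace Summit.HubbardSuperconductivity.BirComplexStableXYNegative

open scoped BigOperators
open MeasureTheory Literature.Probability.LatticeModels
open Summit.HubbardSuperconductivity.HubbardSuperconductivity.Theses.BalabanIR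

noncomputable section

/-- the local generating function `F` of any table is continuous in the window configuration
(a finite sum of exponentials of real linear forms). -/
theorem continuous_genF {r : ℕ} (c : Table r) : Continuous (genF c) := by
  have h : genF c = fun φ => ∑ n ∈ c.support,
      c n * Complex.exp (Complex.I * ((∑ w, (n w : ℝ) * φ w : ℝ) : ℂ)) := rfl
  rw [h]
  fun_prop

/-- compositional form of `continuous_genF` (for `fun_prop`). -/
@[fun_prop]
theorem continuous_genF_comp {X : Type*} [TopologicalSpace X] {r : ℕ} (c : Table r)
    {f : X → W r → ℝ} (hf : Continuous f) : Continuous fun x => genF c (f x) :=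
  (continuous_genF c).comp hf

/-- the witness generating function is affine in the two table parameters. -/
theorem genF_witness_eq (a b : ℝ) (φ : W 2 → ℝ) :
    genF (witness a b) φ = genF spatialTab φ + ((1 : ℂ) + Complex.I * a) * genF temporalCosTab φ
      + (Complex.I * b) * genF temporalSinTab φ := by
  simp only [witness, genF_add, genF_smul]

/-- the witness action is jointly continuous in (table parameters, configuration): compositional form. -/
theorem continuous_action_witness_comp {X : Type*} [TopologicalSpace X] (K : ℝ) (L M : ℕ)
    [NeZero L] [NeZero M] {a b : X → ℝ} {θ : X → Λ L M → ℝ}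
    (ha : Continuous a) (hb : Continuous b) (hθ : Continuous θ) :
    Continuous fun x => action K (witness (a x) (b x)) L M (θ x) := by
  simp only [action, genF_witness_eq]
  fun_prop

/-- the modulus of the witness Boltzmann weight `e^{-A}` does not depend on the table parameters:
it is `exp (-K Σ_s S12)`. -/
theorem norm_exp_neg_action_witness (K : ℝ) (L M : ℕ) [NeZero L] [NeZero M] (a b : ℝ)
    (θ : Λ L M → ℝ) :
    ‖Complex.exp (-(action K (witness a b) L M θ))‖ =
      Real.exp (-(K * ∑ s : Λ L M, S12 (fun w => θ (sh L M s w)))) := by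
  rw [Complex.norm_exp, Complex.neg_re]
  unfold action
  rw [Complex.re_ofReal_mul, Complex.re_sum]
  simp only [genF_witness_re]

/-- the witness Boltzmann weight is continuous in the configuration at fixed parameters. -/
theorem continuous_exp_neg_action_witness (K : ℝ) (L M : ℕ) [NeZero L] [NeZero M] (a b : ℝ) :
    Continuous fun θ : Λ L M → ℝ => Complex.exp (-(action K (witness a b) L M θ)) :=
  (continuous_action_witness_comp K L M (a := fun _ => a) (b := fun _ => b) (θ := fun θ => θ)
    continuous_const continuous_const continuous_id).neg.cexp

/-- S0 of line `theta-rotor-equimodular-zeros`: the witness partition function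
`(ε₁, ε₂) ↦ Z = partZ K (witness ε₁ ε₂) L M` is jointly continuous (dominated convergence on the
compact cube, dominating function = the integrand's modulus, which is parameter independent). -/
theorem continuous_partZ_witness (K : ℝ) (L M : ℕ) [NeZero L] [NeZero M] :
    Continuous (fun q : ℝ × ℝ => partZ K (witness q.1 q.2) L M) := by
  unfold partZ
  refine MeasureTheory.continuous_of_dominated
    (bound := fun θ => ‖Complex.exp (-(action K (witness 0 0) L M θ))‖) ?_ ?_ ?_ ?_
  · intro q
    exact (continuous_exp_neg_action_witness K L M q.1 q.2).aestronglyMeasurable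
  · intro q
    exact Filter.Eventually.of_forall fun θ =>
      (by rw [norm_exp_neg_action_witness, norm_exp_neg_action_witness])
  · have hK : IsCompact (cube L M) := isCompact_univ_pi fun _ => isCompact_Icc
    exact ((continuous_exp_neg_action_witness K L M 0 0).norm).continuousOn.integrableOn_compact hK
  · exact Filter.Eventually.of_forall fun θ =>
      (continuous_action_witness_comp K L M (a := fun q : ℝ × ℝ => q.1) (b := fun q => q.2)
        (θ := fun _ => θ) continuous_fst continuous_snd continuous_const).neg.cexp

/-- S0 (registered stub signature): the witness partition function is jointly continuous in the two
table parameters. -/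
theorem stub_partZ_witness_continuous :
    ∀ (K : ℝ) (L M : ℕ) [NeZero L] [NeZero M],
      Continuous (fun q : ℝ × ℝ => partZ K (witness q.1 q.2) L M) :=
  fun K L M _ _ => continuous_partZ_witness K L M

end

end Summit.HubbardSuperconductivity.BirComplexStableXYNegative
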